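import Summits.CriticalPhenomena.PercolationContinuityZ3.Theorems.Transplant.FKConnectivityAllQFastEval
import HarnessLib

/-!
# The fast kernel evaluator, file 2: the closure of `{u}` IS the open cluster of `u`; `comps` records each cluster once
# (`kOf = clusterCount`), `joinedB` decides reachability, `forestB` decides `IsForestCfg`

Support file (`--supports stmt-CriticalPhenomena-4575`), FK sub-lane `prim-bschramm-fk-1` (gen 17) of the post-continuity programme;
builds on p205010 (kernel theorem, internal audit signed; external expert review pending).  No definitions, no named facts, no sorries;
standard axioms.  Continues `…FastEval.lean` (definitions and the one-round specification there):
* `reachable_of_testBit_iterate` (soundness of the rounds, induction on the fuel) and `testBit_iterate_of_walk` (completeness along an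
  open walk, induction on the walk) give **`testBit_closure_iff`**: with fuel `n = |V|` the closure of `{u}` is exactly the open cluster
  of `u` (a shortest open path has length `< n`);
* **`comps_spec`**: scanning the vertices upward with the invariant "`vis` = union of the clusters of the scanned vertices", the recorded
  closures are exactly the closures of the vertices LEAST in their cluster; hence `mem_compsOf_iff`, **`kOf_eq_clusterCount`** (through
  fk-3 g5's `natCard_connectedComponent_eq_card_filter`), **`joinedB_iff`**, `popc_eq_card`, and **`forestB_iff`** (census g20's
  `isForestCfg_conf_iff`: forest `⟺ k + |ω| = n`).
[cite: Grimmett2006, §1.2 eq. (1.1) (p. 4); §1.5 (p. 13)]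
-/

namespace Summit.CriticalPhenomena.PercolationContinuityZ3.Theorems

namespace FK

namespace RCEval

open Literature.Probability.LatticeModels Literature.Probability.Percolation
open scoped Classical

variable {D : RCEval}

section Graph

variable (a : ℕ)

/-- **Soundness of the rounds**: every bit of `expand^[f] {u}` is joined to `u`. [cite: Grimmett2006, §1.2 (p. 4)] -/
theorem reachable_of_testBit_iterate (u x : Fin D.n) (f : ℕ)
    (h : ((expand (D.openEM a))^[f] (2 ^ u.val)).testBit x.val = true) : (openGraph (D.conf (D.tOf a))).Reachable u x := by
  induction f generalizing x with
  | zero =>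
    rw [Function.iterate_zero, id, Nat.testBit_two_pow, decide_eq_true_iff] at h
    have : u = x := Fin.ext h
    subst this; exact SimpleGraph.Reachable.refl _
  | succ f ih =>
    rw [Function.iterate_succ_apply', testBit_expand] at h
    rcases h with h | ⟨em, hem, ⟨j, hj, hemj⟩, hemx⟩
    · exact ih x h
    · obtain ⟨i, hi, rfl⟩ := (mem_openEM a em).1 hem
      rw [testBit_lor_two_pow] at hemj hemx
      -- `j` is an endpoint of the open pair `i`, already reached; `x` is an endpoint too
      have hends : ∀ y : Fin D.n, (y.val = (D.src i).val ∨ y.val = (D.dst i).val) →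
          (openGraph (D.conf (D.tOf a))).Reachable (D.src i) y ∧ (openGraph (D.conf (D.tOf a))).Reachable (D.dst i) y := by
        intro y hy
        have hadj : D.src i ≠ D.dst i → (openGraph (D.conf (D.tOf a))).Adj (D.src i) (D.dst i) := fun hne =>
          (adj_conf_tOf_iff a _ _).2 ⟨⟨i, hi, rfl⟩, hne⟩
        rcases hy with hy | hy
        · have : y = D.src i := Fin.ext hy
          subst this
          refine ⟨SimpleGraph.Reachable.refl _, ?_⟩
          by_cases hne : D.src i = D.dst i
          · rw [← hne]
          · exact (hadj hne).reachable.symm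
        · have : y = D.dst i := Fin.ext hy
          subst this
          refine ⟨?_, SimpleGraph.Reachable.refl _⟩
          by_cases hne : D.src i = D.dst i
          · rw [hne]
          · exact (hadj hne).reachable
      have hjlt : j < D.n := by rcases hemj with rfl | rfl <;> exact Fin.is_lt _
      have hju := ih ⟨j, hjlt⟩ hj
      rcases hemj with hj' | hj'
      · -- j = src i
        have hjeq : (⟨j, hjlt⟩ : Fin D.n) = D.src i := Fin.ext hj'
        rw [hjeq] at hju
        exact hju.trans (hends x hemx).1
      · have hjeq : (⟨j, hjlt⟩ : Fin D.n) = D.dst i := Fin.ext hj'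
        rw [hjeq] at hju
        exact hju.trans (hends x hemx).2

/-- **Completeness of the rounds**: a vertex with an open walk of length `≤ f` to `u` is a bit of `expand^[f] {u}`.
[cite: Grimmett2006, §1.2 (p. 4)] -/
theorem testBit_iterate_of_walk (u x : Fin D.n) (p : (openGraph (D.conf (D.tOf a))).Walk x u) :
    ∀ f : ℕ, p.length ≤ f → ((expand (D.openEM a))^[f] (2 ^ u.val)).testBit x.val = true := by
  induction p with
  | nil =>
    intro f _
    exact testBit_iterate_mono _ _ _ (Nat.zero_le f) (by rw [Function.iterate_zero, id, Nat.testBit_two_pow]; exact decide_eq_true rfl)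
  | @cons x w u' hadj q ih =>
    intro f hf
    rw [SimpleGraph.Walk.length_cons] at hf
    obtain ⟨f', rfl⟩ : ∃ f', f = f' + 1 := ⟨f - 1, by omega⟩
    have hw := ih f' (by omega)
    rw [Function.iterate_succ_apply', testBit_expand]
    refine Or.inr ?_
    obtain ⟨⟨i, hi, hedge⟩, hne⟩ := (adj_conf_tOf_iff a x w).1 hadj
    refine ⟨Nat.lor (2 ^ (D.src i).val) (2 ^ (D.dst i).val), (mem_openEM a _).2 ⟨i, hi, rfl⟩, ⟨w.val, hw, ?_⟩, ?_⟩
    · rw [testBit_lor_two_pow]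
      change s(D.src i, D.dst i) = s(x, w) at hedge
      rcases Sym2.eq_iff.1 hedge with ⟨h1, h2⟩ | ⟨h1, h2⟩
      · exact Or.inr (congrArg Fin.val h2).symm
      · exact Or.inl (congrArg Fin.val h1).symm
    · rw [testBit_lor_two_pow]
      change s(D.src i, D.dst i) = s(x, w) at hedge
      rcases Sym2.eq_iff.1 hedge with ⟨h1, h2⟩ | ⟨h1, h2⟩
      · exact Or.inl (congrArg Fin.val h1).symm
      · exact Or.inr (congrArg Fin.val h2).symm

/-- **The closure of `{u}` with fuel `n` is exactly the open cluster of `u`.** [cite: Grimmett2006, §1.2 eq. (1.1) (p. 4)] -/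
theorem testBit_closure_iff (u x : Fin D.n) :
    (closure (D.openEM a) D.n (2 ^ u.val)).testBit x.val = true ↔ (openGraph (D.conf (D.tOf a))).Reachable u x := by
  rw [closure_eq_iterate]
  refine ⟨reachable_of_testBit_iterate a u x D.n, fun h => ?_⟩
  obtain ⟨p, hp⟩ := h.symm.exists_isPath
  have hlen := hp.length_lt
  rw [Fintype.card_fin] at hlen
  exact testBit_iterate_of_walk a u x p D.n hlen.le

/-- **The scan `comps` records exactly the closures of the vertices least in their cluster**, given that `vis` covers the clusters
of the vertices already scanned. [cite: Grimmett2006, §1.2 eq. (1.1) (p. 4)] -/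
theorem comps_spec (k : ℕ) (hk : k ≤ D.n) (vis : ℕ) (acc : List ℕ)
    (hvis : ∀ x : Fin D.n, vis.testBit x.val = true ↔
      ∃ u : Fin D.n, u.val < D.n - k ∧ (openGraph (D.conf (D.tOf a))).Reachable u x) :
    (∀ C, C ∈ D.comps (D.openEM a) k vis acc ↔ C ∈ acc ∨ ∃ w : Fin D.n,
        (∀ u : Fin D.n, (openGraph (D.conf (D.tOf a))).Reachable u w → w ≤ u) ∧ D.n - k ≤ w.val ∧
          C = closure (D.openEM a) D.n (2 ^ w.val)) ∧
      (D.comps (D.openEM a) k vis acc).length = acc.length +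
        (Finset.univ.filter fun w : Fin D.n =>
          (∀ u : Fin D.n, (openGraph (D.conf (D.tOf a))).Reachable u w → w ≤ u) ∧ D.n - k ≤ w.val).card := by
  classical
  induction k generalizing vis acc with
  | zero =>
    have hempty : (Finset.univ.filter fun w : Fin D.n =>
        (∀ u : Fin D.n, (openGraph (D.conf (D.tOf a))).Reachable u w → w ≤ u) ∧ D.n - 0 ≤ w.val) = ∅ := by
      refine Finset.filter_eq_empty_iff.2 fun w _ h => ?_
      have := w.is_lt; omega
    refine ⟨fun C => ⟨Or.inl, fun h => h.elim id ?_⟩, ?_⟩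
    · rintro ⟨w, -, hw, -⟩; have := w.is_lt; omega
    · show acc.length = _
      rw [hempty, Finset.card_empty, Nat.add_zero]
  | succ k ih =>
    set G := openGraph (D.conf (D.tOf a)) with hG
    set es := D.openEM a with hes
    have hvlt : D.n - (k + 1) < D.n := by omega
    set v : Fin D.n := ⟨D.n - (k + 1), hvlt⟩ with hv
    have hnk : D.n - k = v.val + 1 := by simp [hv]; omega
    -- the recorded closure of `v`
    have hC : ∀ x : Fin D.n, (closure es D.n (2 ^ v.val)).testBit x.val = true ↔ G.Reachable v x := testBit_closure_iff a v
    have step : D.comps es (k + 1) vis acc = cond (Nat.beq (Nat.land vis (2 ^ v.val)) 0)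
        (D.comps es k (Nat.lor vis (closure es D.n (2 ^ v.val))) (closure es D.n (2 ^ v.val) :: acc)) (D.comps es k vis acc) := rfl
    cases hb : Nat.beq (Nat.land vis (2 ^ v.val)) 0
    · -- `v` already covered: not least in its cluster
      rw [hb, cond_false] at step
      rw [step]
      have hvbit : vis.testBit v.val = true := (land_two_pow_ne_zero_iff vis v.val).1 (Nat.ne_of_beq_eq_false hb)
      obtain ⟨u₀, hu₀, hru₀⟩ := (hvis v).1 hvbit
      have hnotmin : ¬ (∀ u : Fin D.n, G.Reachable u v → v ≤ u) := fun h => by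
        have := h u₀ hru₀; rw [Fin.le_def] at this; omega
      have hvis' : ∀ x : Fin D.n, vis.testBit x.val = true ↔ ∃ u : Fin D.n, u.val < D.n - k ∧ G.Reachable u x := by
        intro x; rw [hvis x, hnk]
        constructor
        · rintro ⟨u, hu, hr⟩; exact ⟨u, by omega, hr⟩
        · rintro ⟨u, hu, hr⟩
          rcases Nat.lt_succ_iff_lt_or_eq.1 hu with hu | hu
          · exact ⟨u, hu, hr⟩
          · have : u = v := Fin.ext hu
            subst this
            exact ⟨u₀, hu₀, hru₀.trans hr⟩
      obtain ⟨ihmem, ihlen⟩ := ih (by omega) vis acc hvis'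
      have hfilt : (Finset.univ.filter fun w : Fin D.n => (∀ u : Fin D.n, G.Reachable u w → w ≤ u) ∧ D.n - (k + 1) ≤ w.val) =
          (Finset.univ.filter fun w : Fin D.n => (∀ u : Fin D.n, G.Reachable u w → w ≤ u) ∧ D.n - k ≤ w.val) := by
        refine Finset.filter_congr fun w _ => ⟨fun h => ⟨h.1, ?_⟩, fun h => ⟨h.1, by omega⟩⟩
        rcases Nat.lt_or_eq_of_le h.2 with hlt | heq
        · omega
        · exact absurd (show w = v from Fin.ext (by rw [hv]; exact heq.symm)) fun hwv => hnotmin (hwv ▸ h.1)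
      refine ⟨fun C => ?_, ?_⟩
      · rw [ihmem C]
        refine or_congr_right ⟨?_, ?_⟩
        · rintro ⟨w, hmin, hw, hCw⟩; exact ⟨w, hmin, by omega, hCw⟩
        · rintro ⟨w, hmin, hw, hCw⟩
          refine ⟨w, hmin, ?_, hCw⟩
          rcases Nat.lt_or_eq_of_le hw with hlt | heq
          · omega
          · exact absurd (show w = v from Fin.ext (by rw [hv]; exact heq.symm)) fun hwv => hnotmin (hwv ▸ hmin)
      · rw [ihlen, hfilt]
    · -- `v` not yet covered: least in its cluster, recorded
      rw [hb, cond_true] at step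
      rw [step]
      have hvbit : ¬ vis.testBit v.val = true := fun h =>
        (land_two_pow_ne_zero_iff vis v.val).2 h (Nat.eq_of_beq_eq_true hb)
      have hmin : ∀ u : Fin D.n, G.Reachable u v → v ≤ u := by
        intro u hu
        by_contra hlt
        rw [Fin.not_le] at hlt
        exact hvbit ((hvis v).2 ⟨u, by rw [Fin.lt_def] at hlt; simpa [hv] using hlt, hu⟩)
      have hvis' : ∀ x : Fin D.n, (Nat.lor vis (closure es D.n (2 ^ v.val))).testBit x.val = true ↔
          ∃ u : Fin D.n, u.val < D.n - k ∧ G.Reachable u x := by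
        intro x
        rw [Nat.lor_eq, Nat.testBit_or, Bool.or_eq_true, hvis x, hC x, hnk]
        constructor
        · rintro (⟨u, hu, hr⟩ | hr)
          · exact ⟨u, by omega, hr⟩
          · exact ⟨v, Nat.lt_succ_self _, hr⟩
        · rintro ⟨u, hu, hr⟩
          rcases Nat.lt_succ_iff_lt_or_eq.1 hu with hu | hu
          · exact Or.inl ⟨u, hu, hr⟩
          · have : u = v := Fin.ext hu
            subst this; exact Or.inr hr
      obtain ⟨ihmem, ihlen⟩ := ih (by omega) _ (closure es D.n (2 ^ v.val) :: acc) hvis'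
      have hvnot : v ∉ (Finset.univ.filter fun w : Fin D.n => (∀ u : Fin D.n, G.Reachable u w → w ≤ u) ∧ D.n - k ≤ w.val) := by
        rw [Finset.mem_filter]; rintro ⟨-, -, h⟩; omega
      have hfilt : (Finset.univ.filter fun w : Fin D.n => (∀ u : Fin D.n, G.Reachable u w → w ≤ u) ∧ D.n - (k + 1) ≤ w.val) =
          insert v (Finset.univ.filter fun w : Fin D.n => (∀ u : Fin D.n, G.Reachable u w → w ≤ u) ∧ D.n - k ≤ w.val) := by
        ext w
        rw [Finset.mem_insert, Finset.mem_filter, Finset.mem_filter]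
        constructor
        · rintro ⟨-, hminw, hw⟩
          rcases Nat.lt_or_eq_of_le hw with hlt | heq
          · exact Or.inr ⟨Finset.mem_univ _, hminw, by omega⟩
          · exact Or.inl (Fin.ext (by rw [hv]; exact heq.symm))
        · rintro (rfl | ⟨-, hminw, hw⟩)
          · exact ⟨Finset.mem_univ _, hmin, le_rfl⟩
          · exact ⟨Finset.mem_univ _, hminw, by omega⟩
      refine ⟨fun C => ?_, ?_⟩
      · rw [ihmem C, List.mem_cons]
        constructor
        · rintro ((rfl | hC') | ⟨w, hminw, hw, hCw⟩)
          · exact Or.inr ⟨v, hmin, le_rfl, rfl⟩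
          · exact Or.inl hC'
          · exact Or.inr ⟨w, hminw, by omega, hCw⟩
        · rintro (hC' | ⟨w, hminw, hw, hCw⟩)
          · exact Or.inl (Or.inr hC')
          · rcases Nat.lt_or_eq_of_le hw with hlt | heq
            · exact Or.inr ⟨w, hminw, by omega, hCw⟩
            · have : w = v := Fin.ext (by rw [hv]; exact heq.symm)
              subst this
              exact Or.inl (Or.inl hCw)
      · rw [ihlen, List.length_cons, hfilt, Finset.card_insert_of_notMem hvnot]
        omega

/-- **The recorded closures are the closures of the least vertices of the clusters.** [cite: Grimmett2006, §1.2 eq. (1.1) (p. 4)] -/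
theorem mem_compsOf_iff (C : ℕ) : C ∈ D.compsOf a ↔ ∃ w : Fin D.n,
    (∀ u : Fin D.n, (openGraph (D.conf (D.tOf a))).Reachable u w → w ≤ u) ∧ C = closure (D.openEM a) D.n (2 ^ w.val) := by
  have h := (comps_spec a D.n le_rfl 0 [] (fun x => by simp)).1 C
  unfold compsOf
  rw [h]
  simp only [List.not_mem_nil, false_or, Nat.sub_self, Nat.zero_le, true_and]

/-- **`kOf` = number of vertices least in their cluster.** [cite: Grimmett2006, §1.2 eq. (1.1) (p. 4)] -/
theorem kOf_eq_card_filter :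
    D.kOf a = (Finset.univ.filter fun w : Fin D.n => ∀ u : Fin D.n, (openGraph (D.conf (D.tOf a))).Reachable u w → w ≤ u).card := by
  classical
  have h := (comps_spec a D.n le_rfl 0 [] (fun x => by simp)).2
  unfold kOf compsOf
  rw [h, List.length_nil, Nat.zero_add]
  congr 1
  exact Finset.filter_congr fun w _ => by simp

/-- **`kOf` computes the tree's cluster count** `clusterCount (conf (tOf a)) ∅`. [cite: Grimmett2006, §1.2 eq. (1.1) (p. 4)] -/
theorem kOf_eq_clusterCount : D.kOf a = clusterCount (D.conf (D.tOf a)) ∅ := by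
  classical
  unfold clusterCount
  rw [wired_empty, sup_bot_eq, natCard_connectedComponent_eq_card_filter]
  convert kOf_eq_card_filter a using 0

/-- **`joinedB` on the recorded closures decides open reachability.** [cite: Grimmett2006, §1.2 eq. (1.1) (p. 4)] -/
theorem joinedB_iff (u v : Fin D.n) :
    joinedB (D.compsOf a) u.val v.val = true ↔ (openGraph (D.conf (D.tOf a))).Reachable u v := by
  classical
  unfold joinedB
  rw [List.any_eq_true]
  simp only [Bool.and_eq_true, not_beq_land_two_pow_iff, mem_compsOf_iff]
  constructor
  · rintro ⟨C, ⟨w, -, rfl⟩, hu, hv⟩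
    exact ((testBit_closure_iff a w u).1 hu).symm.trans ((testBit_closure_iff a w v).1 hv)
  · intro huv
    let S : Finset (Fin D.n) := Finset.univ.filter fun w => (openGraph (D.conf (D.tOf a))).Reachable w u
    have hS : S.Nonempty := ⟨u, by simp [S]⟩
    have hwu : (openGraph (D.conf (D.tOf a))).Reachable (S.min' hS) u := by simpa [S] using Finset.min'_mem S hS
    refine ⟨closure (D.openEM a) D.n (2 ^ (S.min' hS).val), ⟨S.min' hS, fun u' hu' => Finset.min'_le S u' ?_, rfl⟩,
      (testBit_closure_iff a _ u).2 hwu, (testBit_closure_iff a _ v).2 (hwu.trans huv)⟩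
    simpa [S] using hu'.trans hwu

/-- **`popc` is the number of open listed pairs.** [folklore] -/
theorem popc_eq_card : D.popc a = (D.tOf a).card := by
  unfold popc openEM pm tOf
  rw [List.length_filterMap_eq_countP, List.countP_map]
  have h1 : ((List.finRange D.m).countP
      ((fun p : ℕ × ℕ => (cond (Nat.beq (Nat.land a p.1) 0) none (some p.2)).isSome) ∘
        fun i : Fin D.m => (2 ^ i.val, Nat.lor (2 ^ (D.src i).val) (2 ^ (D.dst i).val)))) =
      (List.finRange D.m).countP fun i => a.testBit i.val := by
    refine List.countP_congr fun i _ => ?_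
    rw [← not_beq_land_two_pow_iff]
    simp only [Function.comp]
    cases Nat.beq (Nat.land a (2 ^ i.val)) 0 <;> simp
  rw [h1, List.countP_eq_length_filter, ← List.toFinset_card_of_nodup ((List.nodup_finRange _).filter _),
    List.toFinset_filter, List.toFinset_finRange]

/-- **`forestB` decides `IsForestCfg`** (no listed loops, valid data). [cite: Grimmett2006, §1.5 (p. 13)] -/
theorem forestB_iff (hD : D.Valid) (hl : ∀ i, D.src i ≠ D.dst i) : D.forestB a = true ↔ IsForestCfg (D.conf (D.tOf a)) := by
  unfold forestB
  rw [Nat.beq_eq, isForestCfg_conf_iff hD hl, ← clusterCount_conf, ← kOf_eq_clusterCount, popc_eq_card]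

end Graph

end RCEval

end FK

end Summit.CriticalPhenomena.PercolationContinuityZ3.Theorems
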